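import Summits.QuantumAdvantage.QuantumAdvantage.Theorems.MobiusLadderLiouvilleOrthogonalTC0StubPhaseTail
import Summits.QuantumAdvantage.QuantumAdvantage.Theorems.MobiusLadderLiouvilleOrthogonalTC0StubGelfondSmall
import Summits.QuantumAdvantage.QuantumAdvantage.Theorems.MobiusLadderLiouvilleOrthogonalTC0StubSliceL2
import Summits.QuantumAdvantage.QuantumAdvantage.Theorems.MobiusLadderLiouvilleOrthogonalTC0StubSliceTail
import Summits.QuantumAdvantage.QuantumAdvantage.Theorems.MobiusLadderLiouvilleOrthogonalTC0StubSliceCriterion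
import Summits.QuantumAdvantage.QuantumAdvantage.Theorems.MobiusLadderLiouvilleOrthogonalTC0StubSymmetricRung
import Summits.QuantumAdvantage.QuantumAdvantage.Theorems.MobiusLadderLiouvilleOrthogonalTC0Defs
import Literature.Computability.Complexity.Circuit
import HarnessLib

/-!
# Crux `MobiusLadder.LiouvilleOrthogonalTC0` (stmt-QuantumAdvantage-1393): the symmetric-digital rung —
`λ` is orthogonal to every function of the Hamming weight of the digits, under one Gelfond-type hypothesis

Line `Sketch`, skeleton v8 (lead `prover-line-stmt-QuantumAdvantage-1393-c5-0`). The quotable form of v8,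
assembled from the landed stubs (`stub_phaseTail` p132288, `stub_gelfondSmall_of_tail` p132581,
`stub_sliceL2` p132817, `stub_sliceTail` p132745, `stub_sliceCriterion_of` p132959, `stub_symmetricRung`
p133033). With the Gelfond sums `S_n(α) = Σ_{N<2ⁿ} λ(N) e(α s₂(N))`, `s₂(N) = #{i < n : bit_i(N) = 1}`:

* `gelfondSum_small` (UNCONDITIONAL): there is `a > 0` such that for every `B`, eventually in `n`,
  `|S_n(α)| ≤ 2ⁿ/n^B` for all `|α| ≤ n^{a−1/2}` — from the tree's PROVED `WalshLiouvilleBound` (Bourgain)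
  by the exact Krawtchouk–Walsh expansion of `e(α s₂)` and Green's splitting;
* `slice_criterion` (UNCONDITIONAL): for every `ε > 0`, eventually in `n`, a uniform bound `2ⁿ/n` at the
  `n + 1` frequencies `k/(n+1)` forces `|Σ_{N<2ⁿ} λ(N) G(s₂(N))| ≤ ε 2ⁿ` for every bounded `G`
  (discrete Parseval on the Hamming slices + Cauchy–Schwarz on the central slices + Hoeffding);
* `liouville_orthogonal_symmetric_of_gelfondDecay`: IF the large-frequency Gelfond bound holds
  (`∀ a > 0, ∀ B, ∀ᶠ n, ∀ α, n^{a−1/2} ≤ |α| ≤ 1/2 → |S_n(α)| ≤ 2ⁿ/n^B` — Mauduit–Rivat strength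
  `x^{−c‖α‖²}` is in print for `Λ` (Mauduit–Rivat, Ann. of Math. 171 (2010), Thm 1) and `μ`
  (Mauduit–Rivat, JEMS 17 (2015), Thm 2 with MR2010 Lemmas 9, 16); for `λ` by the same type-I/II method,
  cf. the tree's `LiouvilleWalshVaughan.sum_liouville_mul_eq_vaughan`, but NOT printed — hence a
  hypothesis, never asserted), THEN `λ` is orthogonal to EVERY Boolean function of `s₂(N)`;
* `liouville_orthogonal_symmetricCircuit_of_gelfondDecay`: the same in the crux's circuit language — every
  circuit (any basis, depth, size) computing a symmetric function of its inputs.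

Why this is the right cut: symmetric functions of the digits are computed by depth-two `MAJ ∘ MAJ` circuits
of top fan-in `2n + 2` and contain functions with completely flat Walsh spectrum (`(−1)^{C(s₂(N),2)}` has all
Walsh coefficients of modulus `2^{1−n/2}`), so no uniform Walsh bound and no spectral concentration can
reach them; an arithmetic input at large frequencies is necessary, and the hypothesis isolates exactly it.
-/

set_option linter.dupNamespace false -- D-0017: single-problem summit ⇒ `QuantumAdvantage.QuantumAdvantage` by design

noncomputable section

namespace Summit.QuantumAdvantage.QuantumAdvantage.Theorems.LiouvilleOrthogonalTC0

open Filter Finset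
open Literature.Computability.Complexity
open Literature.Probability.RandomGraphs.LowDegree (sgn)

/-- **Small frequencies of the Liouville–Gelfond sums (unconditional).** There is `a > 0` such that for
every `B`, for all large `n`, `|Σ_{N<2ⁿ} λ(N) e(α s₂(N))| ≤ 2ⁿ/n^B` whenever `|α| ≤ n^{a−1/2}`
(`stub_gelfondSmall_of_tail` ∘ `stub_phaseTail`; input: the tree's proved Bourgain bound
`WalshLiouvilleBound`). -/
theorem gelfondSum_small :
    ∃ a : ℝ, 0 < a ∧ ∀ B : ℕ, ∀ᶠ n : ℕ in atTop, ∀ α : ℝ, |α| ≤ (n : ℝ) ^ (a - 1 / 2) →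
      ‖∑ N ∈ Finset.range (2 ^ n), ((ArithmeticFunction.liouville N : ℤ) : ℂ) *
            Complex.exp (((2 * Real.pi * α *
              ((Finset.univ.filter fun i : Fin n => Nat.testBit N i = true).card : ℝ) : ℝ) : ℂ) * Complex.I)‖
        ≤ (2 : ℝ) ^ n / (n : ℝ) ^ B :=
  stub_gelfondSmall_of_tail stub_phaseTail

/-- **The slice criterion (unconditional).** For every `ε > 0`, for all large `n`: if
`|Σ_{N<2ⁿ} λ(N) e(k s₂(N)/(n+1))| ≤ 2ⁿ/n` for all `k ≤ n`, then `|Σ_{N<2ⁿ} λ(N) G(s₂(N))| ≤ ε 2ⁿ` for every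
`G : ℕ → ℝ` with `|G| ≤ 1` (`stub_sliceCriterion_of` ∘ `stub_sliceL2`, `stub_sliceTail`). -/
theorem slice_criterion :
    ∀ ε : ℝ, 0 < ε → ∀ᶠ n : ℕ in atTop,
      (∀ k ∈ Finset.range (n + 1),
        ‖∑ N ∈ Finset.range (2 ^ n), ((ArithmeticFunction.liouville N : ℤ) : ℂ) *
            Complex.exp (((2 * Real.pi * ((k : ℝ) / (n + 1)) *
              ((Finset.univ.filter fun i : Fin n => Nat.testBit N i = true).card : ℝ) : ℝ) : ℂ) * Complex.I)‖
          ≤ (2 : ℝ) ^ n / n) →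
      ∀ G : ℕ → ℝ, (∀ j, |G j| ≤ 1) →
        |∑ N ∈ Finset.range (2 ^ n), ((ArithmeticFunction.liouville N : ℤ) : ℝ) *
            G (Finset.univ.filter fun i : Fin n => Nat.testBit N i = true).card| ≤ ε * (2 : ℝ) ^ n :=
  stub_sliceCriterion_of stub_sliceL2 stub_sliceTail

/-- **The symmetric-digital rung.** IF the large-frequency Gelfond bound for `λ` holds (hypothesis
`hLarge`: for all `a > 0` and `B`, eventually `|S_n(α)| ≤ 2ⁿ/n^B` for `n^{a−1/2} ≤ |α| ≤ 1/2`), THEN for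
every `ε > 0`, for all large `n`, `|Σ_{N<2ⁿ} λ(N)·sgn G(s₂(N))| ≤ ε·2ⁿ` for EVERY `G : ℕ → Bool`. -/
theorem liouville_orthogonal_symmetric_of_gelfondDecay
    (hLarge : ∀ a : ℝ, 0 < a → ∀ B : ℕ, ∀ᶠ n : ℕ in atTop, ∀ α : ℝ,
      (n : ℝ) ^ (a - 1 / 2) ≤ |α| → |α| ≤ 1 / 2 →
        ‖∑ N ∈ Finset.range (2 ^ n), ((ArithmeticFunction.liouville N : ℤ) : ℂ) *
            Complex.exp (((2 * Real.pi * α *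
              ((Finset.univ.filter fun i : Fin n => Nat.testBit N i = true).card : ℝ) : ℝ) : ℂ) * Complex.I)‖
          ≤ (2 : ℝ) ^ n / (n : ℝ) ^ B) :
    ∀ ε : ℝ, 0 < ε → ∀ᶠ n : ℕ in atTop, ∀ G : ℕ → Bool,
      |∑ N ∈ Finset.range (2 ^ n), ((ArithmeticFunction.liouville N : ℤ) : ℝ) *
          sgn (G (Finset.univ.filter fun i : Fin n => Nat.testBit N i = true).card)| ≤ ε * (2 : ℝ) ^ n :=
  stub_symmetricRung gelfondSum_small hLarge slice_criterion

/-- **The symmetric-digital rung, circuit form.** Under the same hypothesis, for every `ε > 0`, for all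
large `n`, EVERY circuit `C` on `n` inputs (over any gate basis, of any depth and size) that computes a
symmetric function of its inputs (`C(x)` depends only on `#{i : x_i = 1}`) satisfies
`|Σ_{N<2ⁿ} λ(N)·sgn C(bits N)| ≤ ε·2ⁿ` — the v8 case of the composition of line `Sketch`. -/
theorem liouville_orthogonal_symmetricCircuit_of_gelfondDecay
    (hLarge : ∀ a : ℝ, 0 < a → ∀ B : ℕ, ∀ᶠ n : ℕ in atTop, ∀ α : ℝ,
      (n : ℝ) ^ (a - 1 / 2) ≤ |α| → |α| ≤ 1 / 2 →
        ‖∑ N ∈ Finset.range (2 ^ n), ((ArithmeticFunction.liouville N : ℤ) : ℂ) *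
            Complex.exp (((2 * Real.pi * α *
              ((Finset.univ.filter fun i : Fin n => Nat.testBit N i = true).card : ℝ) : ℝ) : ℂ) * Complex.I)‖
          ≤ (2 : ℝ) ^ n / (n : ℝ) ^ B) :
    ∀ ε : ℝ, 0 < ε → ∀ᶠ n : ℕ in atTop, ∀ C : Circuit (Fin n),
      (∃ G : ℕ → Bool, ∀ x : Fin n → Bool,
          C.eval x = G (Finset.univ.filter fun i : Fin n => x i = true).card) →
        |∑ N ∈ Finset.range (2 ^ n), ((ArithmeticFunction.liouville N : ℤ) : ℝ) *
            sgn (C.eval (fun i : Fin n => Nat.testBit N i))| ≤ ε * (2 : ℝ) ^ n := by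
  intro ε hε
  filter_upwards [liouville_orthogonal_symmetric_of_gelfondDecay hLarge ε hε] with n hn C hC
  obtain ⟨G, hG⟩ := hC
  simp only [hG]
  exact hn G

/-! ### Named forms (vocabulary of `…LiouvilleOrthogonalTC0Defs.lean`: `gelfondSum`, `GelfondLiouvilleDecay`) -/

/-- **Small frequencies, named form (unconditional):** `∃ a > 0, ∀ B`, eventually in `n`,
`‖gelfondSum n α‖ ≤ 2ⁿ/n^B` for all `|α| ≤ n^{a−1/2}`. -/
theorem gelfondSum_norm_le_of_abs_le :
    ∃ a : ℝ, 0 < a ∧ ∀ B : ℕ, ∀ᶠ n : ℕ in atTop, ∀ α : ℝ, |α| ≤ (n : ℝ) ^ (a - 1 / 2) →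
      ‖gelfondSum n α‖ ≤ (2 : ℝ) ^ n / (n : ℝ) ^ B :=
  gelfondSum_small

/-- **The symmetric-digital rung, named form:** `GelfondLiouvilleDecay` implies that `λ` is
asymptotically orthogonal to every Boolean function of the Hamming weight of the binary digits. -/
theorem liouville_orthogonal_symmetric (h : GelfondLiouvilleDecay) :
    ∀ ε : ℝ, 0 < ε → ∀ᶠ n : ℕ in atTop, ∀ G : ℕ → Bool,
      |∑ N ∈ Finset.range (2 ^ n), ((ArithmeticFunction.liouville N : ℤ) : ℝ) *
          sgn (G (Finset.univ.filter fun i : Fin n => Nat.testBit N i = true).card)| ≤ ε * (2 : ℝ) ^ n :=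
  liouville_orthogonal_symmetric_of_gelfondDecay h

/-- **The symmetric-digital rung, circuit form, named:** under `GelfondLiouvilleDecay`, every circuit
computing a symmetric function of its `n` inputs is asymptotically orthogonal to `λ` on the digits. -/
theorem liouville_orthogonal_symmetricCircuit (h : GelfondLiouvilleDecay) :
    ∀ ε : ℝ, 0 < ε → ∀ᶠ n : ℕ in atTop, ∀ C : Circuit (Fin n),
      (∃ G : ℕ → Bool, ∀ x : Fin n → Bool,
          C.eval x = G (Finset.univ.filter fun i : Fin n => x i = true).card) →
        |∑ N ∈ Finset.range (2 ^ n), ((ArithmeticFunction.liouville N : ℤ) : ℝ) *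
            sgn (C.eval (fun i : Fin n => Nat.testBit N i))| ≤ ε * (2 : ℝ) ^ n :=
  liouville_orthogonal_symmetricCircuit_of_gelfondDecay h

end Summit.QuantumAdvantage.QuantumAdvantage.Theorems.LiouvilleOrthogonalTC0
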